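import Literature.AlgebraicTopology.SingularHomology.SphereHomology
import Literature.AlgebraicTopology.FundamentalGroup.PuncturedPlane
import Literature.Topology.PlaneTopology.WindingNumber
import Mathlib.AlgebraicTopology.FundamentalGroupoid.FundamentalGroup
import Mathlib.GroupTheory.Abelianization.Defs
import HarnessLib

/-!
# The Hurewicz homomorphism in degree one, and the winding functional on `H₁(ℂ ∖ 0; ℤ)`

Trunk T-ALGTOP (singular homology). Two pieces of textbook algebraic topology absent from Mathlib
and from the tree, proved here for Mathlib's singular homology (`Literature.singularHomology R M X n`,
`Literature.AlgebraicTopology.SingularHomology.SingularChains`):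

1. **The Hurewicz homomorphism `h : π₁(X, x) → H₁(X; M)`** (A. Hatcher, *Algebraic Topology*,
   CUP 2002, §2.A, Thm. 2A.1 — the part "`h` is well defined and a homomorphism"; we do not prove
   that `h` induces `π₁ᵃᵇ ≅ H₁`). A loop `γ` at `x` is a singular `1`-simplex
   `SingularSimplex.ofPath γ` (`…SphereHomology`), the chain `m • γ` is a cycle, and
   `loopClass R M m γ := [m • γ] ∈ H₁(X; M)`. Following Hatcher's proof:
   * *well defined*: a path homotopy `F : γ₀ ≃ γ₁` rel endpoints, cut along the diagonal of the
     square into the singular `2`-simplices `homotopyUpper F`, `homotopyLower F`, gives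
     `∂(F↾upper - F↾lower - κ_y + κ_x) = γ₀ - γ₁` (`d_homotopyChain`; `κ_z` the constant
     `2`-simplex, whose boundary is the constant `1`-simplex);
   * *homomorphism*: the `2`-simplex `ofTrans γ γ'` = `(γ · γ') ∘ [e₀, e₁, e₂ ↦ 0, ½, 1]` has
     boundary `γ' - γ·γ' + γ` (`d_single_ofTrans`);
   * *naturality* `f_* h(γ) = h(f ∘ γ)` (`map_loopClass`).
   Packaged as `hurewiczOne R M m x : π₁(X, x) →* Multiplicative H₁(X; M)` and, through the
   abelianisation, `hurewiczOneAb`. Consequence used downstream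
   (`zpow_abelianization_injective_of_loopClass`): if `k ↦ k • h(γ)` is injective on `ℤ`, the
   class of `γ` has infinite order in `π₁(X, x)ᵃᵇ`.

2. **The winding functional `H₁(ℂ ∖ 0; ℤ) → ℂ`**, `[∑ kᵢ σᵢ] ↦ ∑ kᵢ ∫_{σᵢ} dz/z`, realised with
   continuous logarithms (`Literature/Topology/PlaneTopology/WindingNumber.lean`: `HasLogOn`,
   `hasLogOn_univ`, uniqueness of logarithms `exists_int_eq_add_of_exp_eq`) instead of
   integrals: `edgeLog σ = l(1) - l(0)` for any logarithm `l` of `t ↦ σ(1 - t, t)`; for a singular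
   `2`-simplex `τ` the three edge increments cancel (`edgeLog_boundary'`: lift `τ`, read on the
   square through `(s, t) ↦ (1 - s, s(1 - t), st)`, along one global logarithm on `ℂ ⊇ [0,1]²`), so
   the functional descends to `windH : H₁(ℂ ∖ 0; ℤ) →ₗ[ℤ] ℂ` (`homologyDesc'` of `…SphereHomology`,
   through the comparison `csingularChainComplex.compIso` with concrete chains). On the Hurewicz
   class of the winding loop `t ↦ r e^{2πit}` (`Literature.AlgebraicTopology.FundamentalGroup.PuncturedPlane.windingLoop`) it takes the value
   `2πi` (`windH_loopClass_windingLoop`), whence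
   **`loopClass_windingLoop_smul_injective`**: `k ↦ k • h(winding loop)` is injective, and
   **`zpow_abelianization_windingLoop_injective`**: the winding loop has infinite order in
   `π₁(ℂ ∖ 0)ᵃᵇ` (Hatcher 2002, Thm. 1.7, the injectivity half of `π₁(S¹) ≅ ℤ`; the generation
   half is `Literature.AlgebraicTopology.FundamentalGroup.PuncturedPlane.fromPath_mem_zpowers`).

First client: `Literature/Topology/FourManifolds/DehnSurgeryFramingUniqueness.lean` (the meridian
of a knot has infinite order in `H₁(S³ ∖ K)`, by Mayer–Vietoris).

## Main definitions and statements

* `Literature.AlgebraicTopology.SingularHomology.StdSimplex.toUnitIntervalHalf`, `toSquareUpper`, `toSquareLower`, `ofUnitInterval`,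
  `squareToTwo`: affine parametrisations `Δ² → [0,1]`, `Δ² → [0,1]²`, `[0,1] → Δ¹`, `[0,1]² → Δ²`,
  with the coordinates of the face maps `δᵢ : Δ¹ → Δ²` (`map_succAbove_*`);
* `Literature.AlgebraicTopology.SingularHomology.SingularSimplex.const₂`, `ofTrans`, `homotopyUpper`, `homotopyLower` and their faces;
* `Literature.AlgebraicTopology.SingularHomology.loopClass`, `loopClass_eq_of_homotopic`, `loopClass_refl`, `loopClass_trans`,
  `map_loopClass`, `Literature.AlgebraicTopology.SingularHomology.hurewiczOne`, `Literature.AlgebraicTopology.SingularHomology.hurewiczOneAb`,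
  `Literature.AlgebraicTopology.SingularHomology.zpow_abelianization_injective_of_loopClass`;
* `Literature.AlgebraicTopology.SingularHomology.edgeFun`, `edgeLog`, `edgeLog_eq`, `edgeLog_boundary'`, `Literature.AlgebraicTopology.SingularHomology.windFun`, `windFun_comp_d`,
  `Literature.AlgebraicTopology.SingularHomology.windH`, `windH_loopClass`, `edgeLog_ofPath_windingLoop`,
  `Literature.AlgebraicTopology.SingularHomology.loopClass_windingLoop_smul_injective`, `Literature.AlgebraicTopology.SingularHomology.zpow_abelianization_windingLoop_injective`.

## References

* A. Hatcher, *Algebraic Topology*, CUP 2002, §2.A Thm. 2A.1 (Hurewicz `π₁ → H₁`), §1.1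
  Thm. 1.7 (`π₁(S¹)`), §2.1 (singular chains) [HatcherAT2002].

## Design notes

* Coefficients are general (`R`, `M`, a fixed coefficient `m : M` for the Hurewicz class); the
  winding functional is for `ℤ` coefficients and `m = 1`.
* `unitInterval` is written out (its scoped notation `I` would clash with `Complex.I`, and opening
  the namespace brings the token `σ`).
* Integer multiples `k • c` of homology classes are the `SubNegMonoid` `ℤ`-action (`zsmul`); the
  lemmas used (`map_zsmul`, `sub_zsmul`, `zsmul_zero`) are insensitive to the `Module ℤ` structure
  of the `ModuleCat` objects.
* No declaration in this file uses `sorry`; the main theorems depend only on `propext`,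
  `Classical.choice`, `Quot.sound`.
-/

noncomputable section

open CategoryTheory

universe u v

namespace Literature.AlgebraicTopology.SingularHomology

variable (R : Type v) [CommRing R] (M : Type v) [AddCommGroup M] [Module R M]
variable {X Y : Type u} [TopologicalSpace X] [TopologicalSpace Y]

/-! ### Coordinates of the faces of the standard `2`-simplex -/

namespace StdSimplex

/-- Coordinates of `δᵢ s ∈ Δⁿ⁺¹` at the image `δᵢ j` of a vertex: `(δᵢ s)_{δᵢ j} = s_j`. [folklore] -/
lemma map_succAbove_apply_succAbove {n : ℕ} (i : Fin (n + 2)) (s : StdSimplex n) (j : Fin (n + 1)) :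
    (stdSimplex.map (Fin.succAbove i) s : Fin (n + 2) → ℝ) (Fin.succAbove i j) = s j := by
  rw [stdSimplex_map_eq_affComb, coe_affComb, Finset.sum_apply,
    Finset.sum_eq_single j]
  · simp [stdSimplex.vertex]
  · intro l _ hl
    simp [stdSimplex.vertex, (Fin.succAbove_right_injective).ne hl.symm]
  · simp

/-- Coordinates of `δᵢ s ∈ Δⁿ⁺¹` at the omitted vertex: `(δᵢ s)_i = 0`. [folklore] -/
lemma map_succAbove_apply_self {n : ℕ} (i : Fin (n + 2)) (s : StdSimplex n) :
    (stdSimplex.map (Fin.succAbove i) s : Fin (n + 2) → ℝ) i = 0 := by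
  rw [stdSimplex_map_eq_affComb, coe_affComb, Finset.sum_apply]
  refine Finset.sum_eq_zero fun l _ => ?_
  simp [stdSimplex.vertex, (Fin.succAbove_ne i l).symm]


/-- `δ₀ (s₀, s₁) = (0, s₀, s₁)`, coordinate `1`. [folklore] -/
lemma map_succAbove_zero_apply_one (s : StdSimplex 1) :
    (stdSimplex.map (Fin.succAbove (0 : Fin 3)) s : Fin 3 → ℝ) 1 = s 0 :=
  map_succAbove_apply_succAbove 0 s 0

/-- `δ₀ (s₀, s₁) = (0, s₀, s₁)`, coordinate `2`. [folklore] -/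
lemma map_succAbove_zero_apply_two (s : StdSimplex 1) :
    (stdSimplex.map (Fin.succAbove (0 : Fin 3)) s : Fin 3 → ℝ) 2 = s 1 :=
  map_succAbove_apply_succAbove 0 s 1

/-- `δ₁ (s₀, s₁) = (s₀, 0, s₁)`, coordinate `1`. [folklore] -/
lemma map_succAbove_one_apply_one (s : StdSimplex 1) :
    (stdSimplex.map (Fin.succAbove (1 : Fin 3)) s : Fin 3 → ℝ) 1 = 0 :=
  map_succAbove_apply_self 1 s

/-- `δ₁ (s₀, s₁) = (s₀, 0, s₁)`, coordinate `2`. [folklore] -/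
lemma map_succAbove_one_apply_two (s : StdSimplex 1) :
    (stdSimplex.map (Fin.succAbove (1 : Fin 3)) s : Fin 3 → ℝ) 2 = s 1 :=
  map_succAbove_apply_succAbove 1 s 1

/-- `δ₂ (s₀, s₁) = (s₀, s₁, 0)`, coordinate `1`. [folklore] -/
lemma map_succAbove_two_apply_one (s : StdSimplex 1) :
    (stdSimplex.map (Fin.succAbove (2 : Fin 3)) s : Fin 3 → ℝ) 1 = s 1 :=
  map_succAbove_apply_succAbove 2 s 1

/-- `δ₂ (s₀, s₁) = (s₀, s₁, 0)`, coordinate `2`. [folklore] -/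
lemma map_succAbove_two_apply_two (s : StdSimplex 1) :
    (stdSimplex.map (Fin.succAbove (2 : Fin 3)) s : Fin 3 → ℝ) 2 = 0 :=
  map_succAbove_apply_self 2 s

/-- `s₀ + s₁ = 1` on `Δ¹`. [folklore] -/
lemma one_dim_add (s : StdSimplex 1) : s 0 + s 1 = 1 := by
  have := stdSimplex.sum_eq_one s
  rwa [Fin.sum_univ_two] at this

/-- `t₀ + t₁ + t₂ = 1` on `Δ²`. [folklore] -/
lemma two_dim_add (t : StdSimplex 2) : t 0 + t 1 + t 2 = 1 := by
  have := stdSimplex.sum_eq_one t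
  rwa [Fin.sum_univ_three] at this

/-- The affine map `Δ² → [0, 1]` with vertex values `0, 1/2, 1`: `t ↦ t₁/2 + t₂`. [folklore] -/
def toUnitIntervalHalf : C(StdSimplex 2, unitInterval) :=
  ⟨fun t => ⟨t 1 / 2 + t 2, by
      have h1 := stdSimplex.zero_le t 1
      have h2 := stdSimplex.zero_le t 2
      positivity, by
      have h0 := stdSimplex.zero_le t 0
      have h1 := stdSimplex.zero_le t 1
      have := two_dim_add t
      linarith⟩,
    ((((continuous_apply 1).comp continuous_subtype_val).div_const _).add
      ((continuous_apply 2).comp continuous_subtype_val)).subtype_mk _⟩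

/-- Value of `toUnitIntervalHalf`. [folklore] -/
@[simp] lemma coe_toUnitIntervalHalf (t : StdSimplex 2) :
    (toUnitIntervalHalf t : ℝ) = t 1 / 2 + t 2 := rfl

/-- The affine map `Δ² → [0, 1]²` with vertex values `(0,0), (0,1), (1,1)`: `t ↦ (t₂, t₁ + t₂)`
(upper-left triangle of the square). [folklore] -/
def toSquareUpper : C(StdSimplex 2, unitInterval × unitInterval) :=
  ⟨fun t => (⟨t 2, stdSimplex.zero_le t 2, stdSimplex.le_one t 2⟩,
      ⟨t 1 + t 2, add_nonneg (stdSimplex.zero_le t 1) (stdSimplex.zero_le t 2), by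
        have h0 := stdSimplex.zero_le t 0
        have := two_dim_add t
        linarith⟩),
    (((continuous_apply 2).comp continuous_subtype_val).subtype_mk _).prodMk
      ((((continuous_apply 1).comp continuous_subtype_val).add
        ((continuous_apply 2).comp continuous_subtype_val)).subtype_mk _)⟩

/-- The affine map `Δ² → [0, 1]²` with vertex values `(0,0), (1,0), (1,1)`: `t ↦ (t₁ + t₂, t₂)`
(lower-right triangle of the square). [folklore] -/
def toSquareLower : C(StdSimplex 2, unitInterval × unitInterval) :=
  ⟨fun t => (⟨t 1 + t 2, add_nonneg (stdSimplex.zero_le t 1) (stdSimplex.zero_le t 2), by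
        have h0 := stdSimplex.zero_le t 0
        have := two_dim_add t
        linarith⟩,
      ⟨t 2, stdSimplex.zero_le t 2, stdSimplex.le_one t 2⟩),
    (((((continuous_apply 1).comp continuous_subtype_val).add
        ((continuous_apply 2).comp continuous_subtype_val)).subtype_mk _)).prodMk
      (((continuous_apply 2).comp continuous_subtype_val).subtype_mk _)⟩

/-- First coordinate of `toSquareUpper`. [folklore] -/
@[simp] lemma coe_toSquareUpper_fst (t : StdSimplex 2) : ((toSquareUpper t).1 : ℝ) = t 2 := rfl
/-- Second coordinate of `toSquareUpper`. [folklore] -/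
@[simp] lemma coe_toSquareUpper_snd (t : StdSimplex 2) : ((toSquareUpper t).2 : ℝ) = t 1 + t 2 :=
  rfl
/-- First coordinate of `toSquareLower`. [folklore] -/
@[simp] lemma coe_toSquareLower_fst (t : StdSimplex 2) : ((toSquareLower t).1 : ℝ) = t 1 + t 2 :=
  rfl
/-- Second coordinate of `toSquareLower`. [folklore] -/
@[simp] lemma coe_toSquareLower_snd (t : StdSimplex 2) : ((toSquareLower t).2 : ℝ) = t 2 := rfl


end StdSimplex

/-! ### Evaluating concatenated paths -/

/-- On the first half, `(γ · γ') u = γ v` when `u = v / 2`. [folklore] -/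
lemma Path.trans_apply_left' {x y z : X} (γ : Path x y) (γ' : Path y z) (u v : unitInterval)
    (h : (u : ℝ) = v / 2) : (γ.trans γ') u = γ v := by
  rw [Path.trans_apply, dif_pos (by rw [h]; linarith [v.2.2])]
  congr 1
  exact Subtype.ext (by simp only [h]; ring)

/-- On the second half, `(γ · γ') u = γ' v` when `u = (1 + v) / 2`. [folklore] -/
lemma Path.trans_apply_right' {x y z : X} (γ : Path x y) (γ' : Path y z) (u v : unitInterval)
    (h : (u : ℝ) = (1 + v) / 2) : (γ.trans γ') u = γ' v := by
  rw [Path.trans_apply]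
  split_ifs with hu
  · have hv : (v : ℝ) = 0 := le_antisymm (by rw [h] at hu; linarith) v.2.1
    have hv' : v = 0 := Subtype.ext hv
    have h1 : (⟨2 * (u : ℝ), (unitInterval.mul_pos_mem_iff zero_lt_two).2 ⟨u.2.1, hu⟩⟩ : unitInterval) = 1 :=
      Subtype.ext (by simp only [h, hv, Set.Icc.coe_one]; ring)
    rw [h1, hv', γ.target, γ'.source]
  · congr 1
    exact Subtype.ext (by simp only [h]; ring)

/-! ### Singular `2`-simplices attached to concatenations and to path homotopies -/

namespace SingularSimplex

open StdSimplex

/-- The **constant singular `2`-simplex** at a point. [folklore] -/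
def const₂ (z : X) : SingularSimplex X 2 :=
  toContinuousMap.symm (ContinuousMap.const _ z)

/-- The constant `1`-simplex is the `1`-simplex of the constant path. [folklore] -/
lemma ofPath_refl_apply (z : X) (s : StdSimplex 1) : toContinuousMap (ofPath (Path.refl z)) s = z := by
  rw [ofPath_apply]
  rfl

/-- The faces of the constant `2`-simplex are the `1`-simplices of the constant path. [folklore] -/
lemma const₂_face (z : X) (i : Fin 3) : (const₂ z).face i = ofPath (Path.refl z) := by
  apply toContinuousMap_injective
  ext s : 1
  rw [toContinuousMap_face, ContinuousMap.comp_apply, const₂, Equiv.apply_symm_apply,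
    ContinuousMap.const_apply, ofPath_refl_apply]

/-- The **singular `2`-simplex of a concatenation** `γ · γ'`: the composite of `γ · γ'` with the
affine map `Δ² → [0, 1]`, `(e₀, e₁, e₂) ↦ (0, 1/2, 1)`; its faces are `γ'`, `γ · γ'`, `γ`
(Hatcher, *Algebraic Topology*, proof of Thm. 2A.1). [folklore] -/
def ofTrans {x y z : X} (γ : Path x y) (γ' : Path y z) : SingularSimplex X 2 :=
  toContinuousMap.symm ((γ.trans γ').toContinuousMap.comp toUnitIntervalHalf)

/-- Value of `ofTrans`. [folklore] -/
lemma ofTrans_apply {x y z : X} (γ : Path x y) (γ' : Path y z) (t : StdSimplex 2) :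
    toContinuousMap (ofTrans γ γ') t = (γ.trans γ') (toUnitIntervalHalf t) := by
  rw [ofTrans, Equiv.apply_symm_apply]
  rfl

/-- `(ofTrans γ γ') ∘ δ₀ = γ'`. [folklore] -/
lemma ofTrans_face_zero {x y z : X} (γ : Path x y) (γ' : Path y z) :
    (ofTrans γ γ').face 0 = ofPath γ' := by
  apply toContinuousMap_injective
  ext s : 1
  rw [toContinuousMap_face, ContinuousMap.comp_apply, ofTrans_apply, ofPath_apply]
  refine Path.trans_apply_right' γ γ' _ _ ?_
  rw [coe_toUnitIntervalHalf, coe_toUnitInterval, ContinuousMap.coe_mk,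
    map_succAbove_zero_apply_one, map_succAbove_zero_apply_two]
  linarith [one_dim_add s]

/-- `(ofTrans γ γ') ∘ δ₁ = γ · γ'`. [folklore] -/
lemma ofTrans_face_one {x y z : X} (γ : Path x y) (γ' : Path y z) :
    (ofTrans γ γ').face 1 = ofPath (γ.trans γ') := by
  apply toContinuousMap_injective
  ext s : 1
  rw [toContinuousMap_face, ContinuousMap.comp_apply, ofTrans_apply, ofPath_apply]
  congr 1
  apply Subtype.ext
  rw [coe_toUnitIntervalHalf, coe_toUnitInterval, ContinuousMap.coe_mk,
    map_succAbove_one_apply_one, map_succAbove_one_apply_two, zero_div, zero_add]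

/-- `(ofTrans γ γ') ∘ δ₂ = γ`. [folklore] -/
lemma ofTrans_face_two {x y z : X} (γ : Path x y) (γ' : Path y z) :
    (ofTrans γ γ').face 2 = ofPath γ := by
  apply toContinuousMap_injective
  ext s : 1
  rw [toContinuousMap_face, ContinuousMap.comp_apply, ofTrans_apply, ofPath_apply]
  refine Path.trans_apply_left' γ γ' _ _ ?_
  rw [coe_toUnitIntervalHalf, coe_toUnitInterval, ContinuousMap.coe_mk,
    map_succAbove_two_apply_one, map_succAbove_two_apply_two, add_zero]

variable {x y : X} {γ₀ γ₁ : Path x y}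

/-- The **diagonal path** `t ↦ F (t, t)` of a path homotopy `F` from `γ₀` to `γ₁`. [folklore] -/
def _root_.Path.Homotopy.diagPath (F : Path.Homotopy γ₀ γ₁) : Path x y where
  toFun t := F (t, t)
  continuous_toFun := F.continuous.comp (continuous_id.prodMk continuous_id)
  source' := by rw [F.apply_zero]; exact γ₀.source
  target' := by rw [F.apply_one]; exact γ₁.target

/-- Value of the diagonal path. [folklore] -/
@[simp] lemma _root_.Path.Homotopy.diagPath_apply (F : Path.Homotopy γ₀ γ₁) (t : unitInterval) :
    F.diagPath t = F (t, t) := rfl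

/-- The **upper singular `2`-simplex of a path homotopy** `F : γ₀ ≃ γ₁`: `F` on the triangle
`(0,0), (0,1), (1,1)` of the square; faces: constant `y`, diagonal, `γ₀`
(Hatcher 2002, proof of Thm. 2A.1). [folklore] -/
def homotopyUpper (F : Path.Homotopy γ₀ γ₁) : SingularSimplex X 2 :=
  toContinuousMap.symm ((F.toContinuousMap : C(unitInterval × unitInterval, X)).comp toSquareUpper)

/-- The **lower singular `2`-simplex of a path homotopy** `F : γ₀ ≃ γ₁`: `F` on the triangle
`(0,0), (1,0), (1,1)` of the square; faces: `γ₁`, diagonal, constant `x`. [folklore] -/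
def homotopyLower (F : Path.Homotopy γ₀ γ₁) : SingularSimplex X 2 :=
  toContinuousMap.symm ((F.toContinuousMap : C(unitInterval × unitInterval, X)).comp toSquareLower)

/-- Value of `homotopyUpper`. [folklore] -/
lemma homotopyUpper_apply (F : Path.Homotopy γ₀ γ₁) (t : StdSimplex 2) :
    toContinuousMap (homotopyUpper F) t = F (toSquareUpper t) := by
  rw [homotopyUpper, Equiv.apply_symm_apply]
  rfl

/-- Value of `homotopyLower`. [folklore] -/
lemma homotopyLower_apply (F : Path.Homotopy γ₀ γ₁) (t : StdSimplex 2) :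
    toContinuousMap (homotopyLower F) t = F (toSquareLower t) := by
  rw [homotopyLower, Equiv.apply_symm_apply]
  rfl

/-- `homotopyUpper F ∘ δ₀` is constant `y`. [folklore] -/
lemma homotopyUpper_face_zero (F : Path.Homotopy γ₀ γ₁) :
    (homotopyUpper F).face 0 = ofPath (Path.refl y) := by
  apply toContinuousMap_injective
  ext s : 1
  rw [toContinuousMap_face, ContinuousMap.comp_apply, homotopyUpper_apply, ofPath_refl_apply]
  have h : toSquareUpper (((⟨stdSimplex.map (Fin.succAbove 0), stdSimplex.continuous_map _⟩ :
      C(StdSimplex 1, StdSimplex 2)) s)) = (toUnitInterval s, 1) :=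
    Prod.ext (Subtype.ext (by
      rw [coe_toSquareUpper_fst, ContinuousMap.coe_mk, map_succAbove_zero_apply_two,
        coe_toUnitInterval])) (Subtype.ext (by
      rw [coe_toSquareUpper_snd, ContinuousMap.coe_mk, map_succAbove_zero_apply_one,
        map_succAbove_zero_apply_two, one_dim_add, Set.Icc.coe_one]))
  rw [h, F.target]

/-- `homotopyUpper F ∘ δ₁` is the diagonal path. [folklore] -/
lemma homotopyUpper_face_one (F : Path.Homotopy γ₀ γ₁) :
    (homotopyUpper F).face 1 = ofPath F.diagPath := by
  apply toContinuousMap_injective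
  ext s : 1
  rw [toContinuousMap_face, ContinuousMap.comp_apply, homotopyUpper_apply, ofPath_apply,
    Path.Homotopy.diagPath_apply]
  congr 1
  refine Prod.ext (Subtype.ext ?_) (Subtype.ext ?_)
  · rw [coe_toSquareUpper_fst, ContinuousMap.coe_mk, map_succAbove_one_apply_two,
      coe_toUnitInterval]
  · rw [coe_toSquareUpper_snd, ContinuousMap.coe_mk, map_succAbove_one_apply_one,
      map_succAbove_one_apply_two, coe_toUnitInterval, zero_add]

/-- `homotopyUpper F ∘ δ₂ = γ₀`. [folklore] -/
lemma homotopyUpper_face_two (F : Path.Homotopy γ₀ γ₁) :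
    (homotopyUpper F).face 2 = ofPath γ₀ := by
  apply toContinuousMap_injective
  ext s : 1
  rw [toContinuousMap_face, ContinuousMap.comp_apply, homotopyUpper_apply, ofPath_apply]
  have h : toSquareUpper (((⟨stdSimplex.map (Fin.succAbove 2), stdSimplex.continuous_map _⟩ :
      C(StdSimplex 1, StdSimplex 2)) s)) = (0, toUnitInterval s) :=
    Prod.ext (Subtype.ext (by
      rw [coe_toSquareUpper_fst, ContinuousMap.coe_mk, map_succAbove_two_apply_two,
        Set.Icc.coe_zero])) (Subtype.ext (by
      rw [coe_toSquareUpper_snd, ContinuousMap.coe_mk, map_succAbove_two_apply_one,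
        map_succAbove_two_apply_two, coe_toUnitInterval, add_zero]))
  rw [h, F.apply_zero]
  rfl

/-- `homotopyLower F ∘ δ₀ = γ₁`. [folklore] -/
lemma homotopyLower_face_zero (F : Path.Homotopy γ₀ γ₁) :
    (homotopyLower F).face 0 = ofPath γ₁ := by
  apply toContinuousMap_injective
  ext s : 1
  rw [toContinuousMap_face, ContinuousMap.comp_apply, homotopyLower_apply, ofPath_apply]
  have h : toSquareLower (((⟨stdSimplex.map (Fin.succAbove 0), stdSimplex.continuous_map _⟩ :
      C(StdSimplex 1, StdSimplex 2)) s)) = (1, toUnitInterval s) :=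
    Prod.ext (Subtype.ext (by
      rw [coe_toSquareLower_fst, ContinuousMap.coe_mk, map_succAbove_zero_apply_one,
        map_succAbove_zero_apply_two, one_dim_add, Set.Icc.coe_one])) (Subtype.ext (by
      rw [coe_toSquareLower_snd, ContinuousMap.coe_mk, map_succAbove_zero_apply_two,
        coe_toUnitInterval]))
  rw [h, F.apply_one]
  rfl

/-- `homotopyLower F ∘ δ₁` is the diagonal path. [folklore] -/
lemma homotopyLower_face_one (F : Path.Homotopy γ₀ γ₁) :
    (homotopyLower F).face 1 = ofPath F.diagPath := by
  apply toContinuousMap_injective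
  ext s : 1
  rw [toContinuousMap_face, ContinuousMap.comp_apply, homotopyLower_apply, ofPath_apply,
    Path.Homotopy.diagPath_apply]
  congr 1
  refine Prod.ext (Subtype.ext ?_) (Subtype.ext ?_)
  · rw [coe_toSquareLower_fst, ContinuousMap.coe_mk, map_succAbove_one_apply_one,
      map_succAbove_one_apply_two, coe_toUnitInterval, zero_add]
  · rw [coe_toSquareLower_snd, ContinuousMap.coe_mk, map_succAbove_one_apply_two,
      coe_toUnitInterval]

/-- `homotopyLower F ∘ δ₂` is constant `x`. [folklore] -/
lemma homotopyLower_face_two (F : Path.Homotopy γ₀ γ₁) :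
    (homotopyLower F).face 2 = ofPath (Path.refl x) := by
  apply toContinuousMap_injective
  ext s : 1
  rw [toContinuousMap_face, ContinuousMap.comp_apply, homotopyLower_apply, ofPath_refl_apply]
  have h : toSquareLower (((⟨stdSimplex.map (Fin.succAbove 2), stdSimplex.continuous_map _⟩ :
      C(StdSimplex 1, StdSimplex 2)) s)) = (toUnitInterval s, 0) :=
    Prod.ext (Subtype.ext (by
      rw [coe_toSquareLower_fst, ContinuousMap.coe_mk, map_succAbove_two_apply_one,
        map_succAbove_two_apply_two, coe_toUnitInterval, add_zero])) (Subtype.ext (by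
      rw [coe_toSquareLower_snd, ContinuousMap.coe_mk, map_succAbove_two_apply_two,
        Set.Icc.coe_zero]))
  rw [h, F.source]

/-- Push-forward of the `1`-simplex of a path: `f ∘ (ofPath γ) = ofPath (f ∘ γ)`. [folklore] -/
lemma ofPath_map {x y : X} (γ : Path x y) (f : C(X, Y)) :
    (ofPath γ).map f = ofPath (γ.map f.continuous) := by
  apply toContinuousMap_injective
  ext s : 1
  rw [toContinuousMap_map, ContinuousMap.comp_apply, ofPath_apply, ofPath_apply]
  rfl


end SingularSimplex

/-! ### The chain identities and the Hurewicz class of a loop -/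

section Hurewicz

open SingularSimplex singularChainComplex

variable (m : M)

/-- `∂ (m τ) = m (τ∘δ₀) - m (τ∘δ₁) + m (τ∘δ₂)` for a singular `2`-simplex (Hatcher 2002, §2.1).
[folklore] -/
lemma d_single_two (τ : SingularSimplex X 2) :
    (singularChainComplex R M X).d 2 1 (single (R := R) τ m) =
      single (R := R) (τ.face 0) m - single (R := R) (τ.face 1) m + single (R := R) (τ.face 2) m := by
  rw [d_single, Fin.sum_univ_three]
  simp only [Fin.val_zero, pow_zero, one_smul, Fin.val_one, pow_one, neg_smul, Fin.val_two,
    neg_one_sq]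
  abel

/-- `∂ (m γ) = m [y] - m [x]` for the `1`-simplex of a path (Hatcher 2002, §2.1). [folklore] -/
lemma d_single_ofPath {x y : X} (γ : Path x y) :
    (singularChainComplex R M X).d 1 0 (single (R := R) (ofPath γ) m) =
      single (R := R) (ofPoint y) m - single (R := R) (ofPoint x) m := by
  rw [d_single, Fin.sum_univ_two, ofPath_face_zero, ofPath_face_one]
  simp only [Fin.val_zero, pow_zero, one_smul, Fin.val_one, pow_one, neg_smul]
  abel

/-- `∂ (m κ_z) = m [refl z]`: the constant `1`-simplex is a boundary. [folklore] -/
lemma d_single_const₂ (z : X) :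
    (singularChainComplex R M X).d 2 1 (single (R := R) (const₂ z) m) =
      single (R := R) (ofPath (Path.refl z)) m := by
  rw [d_single_two, const₂_face, const₂_face, const₂_face, sub_self, zero_add]

/-- **Additivity at chain level**: `∂ (m ofTrans γ γ') = m γ' - m (γ · γ') + m γ`
(Hatcher 2002, proof of Thm. 2A.1). [folklore] -/
lemma d_single_ofTrans {x y z : X} (γ : Path x y) (γ' : Path y z) :
    (singularChainComplex R M X).d 2 1 (single (R := R) (ofTrans γ γ') m) =
      single (R := R) (ofPath γ') m - single (R := R) (ofPath (γ.trans γ')) m +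
        single (R := R) (ofPath γ) m := by
  rw [d_single_two, ofTrans_face_zero, ofTrans_face_one, ofTrans_face_two]

variable {x y : X} {γ₀ γ₁ : Path x y}

/-- The `2`-chain of a path homotopy `F : γ₀ ≃ γ₁` whose boundary is `m γ₀ - m γ₁`:
`F↾upper - F↾lower - κ_y + κ_x`. [folklore] -/
def homotopyChain (F : Path.Homotopy γ₀ γ₁) : (singularChainComplex R M X).X 2 :=
  single (R := R) (homotopyUpper F) m - single (R := R) (homotopyLower F) m -
    single (R := R) (const₂ y) m + single (R := R) (const₂ x) m

/-- **Homotopy invariance at chain level**: `∂ (homotopyChain F) = m γ₀ - m γ₁` for a path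
homotopy `F : γ₀ ≃ γ₁` rel endpoints (Hatcher 2002, proof of Thm. 2A.1). [folklore] -/
lemma d_homotopyChain (F : Path.Homotopy γ₀ γ₁) :
    (singularChainComplex R M X).d 2 1 (homotopyChain R M m F) =
      single (R := R) (ofPath γ₀) m - single (R := R) (ofPath γ₁) m := by
  rw [homotopyChain, map_add, map_sub, map_sub, d_single_two, d_single_two, d_single_const₂,
    d_single_const₂, homotopyUpper_face_zero, homotopyUpper_face_one, homotopyUpper_face_two,
    homotopyLower_face_zero, homotopyLower_face_one, homotopyLower_face_two]
  abel

/-- The `1`-chain `m γ` of a loop is a cycle. [folklore] -/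
lemma d_single_ofPath_loop {x : X} (γ : Path x x) :
    (singularChainComplex R M X).d 1 ((ComplexShape.down ℕ).next 1)
      (single (R := R) (ofPath γ) m) = 0 := by
  rw [d_next_eq_zero_iff (ChainComplex.next_nat_succ 0), d_single_ofPath, sub_self]

/-- The **Hurewicz class** `h(γ) = [m γ] ∈ H₁(X; M)` of a loop `γ` at `x` with coefficient `m`
(Hatcher, *Algebraic Topology*, §2.A, the map `h : π₁(X, x₀) → H₁(X)`). [cite: HatcherAT2002, Thm. 2A.1] -/
def loopClass {x : X} (γ : Path x x) : singularHomology R M X 1 :=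
  homologyCls (single (R := R) (ofPath γ) m) (d_single_ofPath_loop R M m γ)

/-- Homotopic loops have the same Hurewicz class (Hatcher 2002, Thm. 2A.1, well-definedness).
[folklore] -/
lemma loopClass_eq_of_homotopic {x : X} {γ γ' : Path x x} (h : γ.Homotopic γ') :
    loopClass R M m γ = loopClass R M m γ' := by
  obtain ⟨F⟩ := h
  rw [loopClass, loopClass, homologyCls_eq_homologyCls_iff,
    exists_d_prev_eq_iff (i := 2) (ChainComplex.prev ℕ 1)]
  exact ⟨homotopyChain R M m F, d_homotopyChain R M m F⟩

/-- The Hurewicz class of the constant loop vanishes. [folklore] -/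
lemma loopClass_refl (x : X) : loopClass R M m (Path.refl x) = 0 := by
  rw [loopClass, homologyCls_eq_zero_iff, exists_d_prev_eq_iff (i := 2) (ChainComplex.prev ℕ 1)]
  exact ⟨single (R := R) (const₂ x) m, d_single_const₂ R M m x⟩

/-- **Additivity**: `h(γ · γ') = h(γ) + h(γ')` (Hatcher 2002, Thm. 2A.1). [folklore] -/
lemma loopClass_trans {x : X} (γ γ' : Path x x) :
    loopClass R M m (γ.trans γ') = loopClass R M m γ + loopClass R M m γ' := by
  rw [loopClass, loopClass, loopClass, ← homologyCls_add, homologyCls_eq_homologyCls_iff,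
    exists_d_prev_eq_iff (i := 2) (ChainComplex.prev ℕ 1)]
  · refine ⟨-single (R := R) (ofTrans γ γ') m, ?_⟩
    rw [map_neg, d_single_ofTrans]
    abel
  · rw [map_add, d_single_ofPath_loop, d_single_ofPath_loop, add_zero]

/-- The Hurewicz class only depends on the singular `1`-simplex of the loop (in particular not
on the base point bookkeeping). [folklore] -/
lemma loopClass_eq_of_ofPath_eq {x y : X} (γ : Path x x) (γ' : Path y y)
    (h : ofPath γ = ofPath γ') : loopClass R M m γ = loopClass R M m γ' :=
  homologyCls_congr (by rw [h]) _ _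

/-- **Naturality** of the Hurewicz class: `f_* h(γ) = h(f ∘ γ)` (Hatcher 2002, §2.A). [folklore] -/
lemma map_loopClass {x : X} (γ : Path x x) (f : C(X, Y)) :
    singularHomology.map R M f 1 (loopClass R M m γ) = loopClass R M m (γ.map f.continuous) := by
  rw [loopClass, loopClass, singularHomology.map, homologyMap_homologyCls]
  exact homologyCls_congr (by rw [map_f_single, ofPath_map]) _ _

/-- The **Hurewicz homomorphism in degree one** `h : π₁(X, x) → H₁(X; M)` with coefficient `m`,
`[γ] ↦ [m γ]`, as a monoid homomorphism to the (multiplicatively written) homology group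
(Hatcher, *Algebraic Topology*, Thm. 2A.1: well defined and a homomorphism). [cite: HatcherAT2002, Thm. 2A.1] -/
def hurewiczOne (x : X) : FundamentalGroup X x →* Multiplicative (singularHomology R M X 1) where
  toFun g := Multiplicative.ofAdd (Quotient.liftOn g (loopClass R M m)
    fun _ _ h => loopClass_eq_of_homotopic R M m h)
  map_one' := by
    change Multiplicative.ofAdd (loopClass R M m (Path.refl x)) = 1
    rw [loopClass_refl, ofAdd_zero]
  map_mul' p q := by
    induction p using Path.Homotopic.Quotient.ind with | mk p =>
    induction q using Path.Homotopic.Quotient.ind with | mk q =>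
    rw [FundamentalGroup.mul_def, ← Path.Homotopic.Quotient.mk_trans]
    change Multiplicative.ofAdd (loopClass R M m (q.trans p)) =
      Multiplicative.ofAdd (loopClass R M m p) * Multiplicative.ofAdd (loopClass R M m q)
    rw [loopClass_trans, ← ofAdd_add, add_comm]

/-- The Hurewicz homomorphism on the class of a loop. [folklore] -/
@[simp] lemma hurewiczOne_fromPath {x : X} (γ : Path x x) :
    hurewiczOne R M m x (FundamentalGroup.fromPath (Path.Homotopic.Quotient.mk γ)) =
      Multiplicative.ofAdd (loopClass R M m γ) := rfl

/-- The **Hurewicz homomorphism on the abelianised fundamental group**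
`π₁(X, x)ᵃᵇ → H₁(X; M)` (Hatcher 2002, Thm. 2A.1). [cite: HatcherAT2002, Thm. 2A.1] -/
def hurewiczOneAb (x : X) :
    Abelianization (FundamentalGroup X x) →* Multiplicative (singularHomology R M X 1) :=
  Abelianization.lift (hurewiczOne R M m x)

/-- `hurewiczOneAb` on the class of a loop. [folklore] -/
@[simp] lemma hurewiczOneAb_of_fromPath {x : X} (γ : Path x x) :
    hurewiczOneAb R M m x (Abelianization.of
      (FundamentalGroup.fromPath (Path.Homotopic.Quotient.mk γ))) =
      Multiplicative.ofAdd (loopClass R M m γ) := by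
  rw [hurewiczOneAb, Abelianization.lift_apply_of, hurewiczOne_fromPath]

/-- **Detecting infinite order through Hurewicz**: if `k ↦ k • h(γ)` is injective on `ℤ`
(e.g. some additive functional of `H₁` is non-zero on `h(γ)` in characteristic zero), then the
class of `γ` has infinite order in `π₁(X, x)ᵃᵇ`: `k ↦ [γ]ᵃᵇ ^ k` is injective. [folklore] -/
theorem zpow_abelianization_injective_of_loopClass {x : X} (γ : Path x x)
    (h : Function.Injective fun k : ℤ => k • loopClass R M m γ) :
    Function.Injective fun k : ℤ => (Abelianization.of
      (FundamentalGroup.fromPath (Path.Homotopic.Quotient.mk γ))) ^ k := by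
  intro k l hkl
  apply h
  have := congrArg (fun g => Multiplicative.toAdd (hurewiczOneAb R M m x g)) hkl
  simpa only [map_zpow, hurewiczOneAb_of_fromPath, toAdd_zpow, toAdd_ofAdd] using this

end Hurewicz


/-! ## Part 2: the winding functional on `H₁(ℂ ∖ 0; ℤ)` -/

section WindingPart

open Complex Set SingularSimplex singularChainComplex StdSimplex FundamentalGroup.PuncturedPlane

/-! ### More coordinates of faces; the square parametrisation of `Δ²` -/

namespace StdSimplex

/-- `δ₀ (s₀, s₁) = (0, s₀, s₁)`, coordinate `0`. [folklore] -/
lemma map_succAbove_zero_apply_zero (s : StdSimplex 1) :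
    (stdSimplex.map (Fin.succAbove (0 : Fin 3)) s : Fin 3 → ℝ) 0 = 0 :=
  map_succAbove_apply_self 0 s

/-- `δ₁ (s₀, s₁) = (s₀, 0, s₁)`, coordinate `0`. [folklore] -/
lemma map_succAbove_one_apply_zero (s : StdSimplex 1) :
    (stdSimplex.map (Fin.succAbove (1 : Fin 3)) s : Fin 3 → ℝ) 0 = s 0 :=
  map_succAbove_apply_succAbove 1 s 0

/-- `δ₂ (s₀, s₁) = (s₀, s₁, 0)`, coordinate `0`. [folklore] -/
lemma map_succAbove_two_apply_zero (s : StdSimplex 1) :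
    (stdSimplex.map (Fin.succAbove (2 : Fin 3)) s : Fin 3 → ℝ) 0 = s 0 :=
  map_succAbove_apply_succAbove 2 s 0

/-- The point `(1 - t, t) ∈ Δ¹` of a parameter `t ∈ [0, 1]`: Mathlib's
`stdSimplexHomeomorphUnitInterval.symm`, the inverse of `toUnitInterval`. [folklore] -/
abbrev ofUnitInterval (t : unitInterval) : StdSimplex 1 := stdSimplexHomeomorphUnitInterval.symm t

/-- Coordinate `0` of `ofUnitInterval t`. [folklore] -/
lemma ofUnitInterval_apply_zero (t : unitInterval) : (ofUnitInterval t : Fin 2 → ℝ) 0 = 1 - t := rfl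

/-- Coordinate `1` of `ofUnitInterval t`. [folklore] -/
lemma ofUnitInterval_apply_one (t : unitInterval) : (ofUnitInterval t : Fin 2 → ℝ) 1 = t := rfl

/-- `toUnitInterval ∘ ofUnitInterval = id`. [folklore] -/
@[simp] lemma toUnitInterval_ofUnitInterval (t : unitInterval) : toUnitInterval (ofUnitInterval t) = t :=
  Subtype.ext rfl

/-- `ofUnitInterval ∘ toUnitInterval = id`. [folklore] -/
@[simp] lemma ofUnitInterval_toUnitInterval (t : StdSimplex 1) :
    ofUnitInterval (toUnitInterval t) = t :=
  stdSimplexHomeomorphUnitInterval.symm_apply_apply t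

/-- `ofUnitInterval` is continuous. [folklore] -/
lemma continuous_ofUnitInterval : Continuous ofUnitInterval :=
  stdSimplexHomeomorphUnitInterval.symm.continuous

/-- The **square parametrisation** of `Δ²`: `(s, t) ↦ (1 - s, s (1 - t), s t)` (collapsing the
edge `s = 0` to the vertex `e₀`). [folklore] -/
def squareToTwo (p : unitInterval × unitInterval) : StdSimplex 2 :=
  ⟨![1 - p.1, p.1 * (1 - p.2), p.1 * p.2], by
    refine ⟨fun i => ?_, ?_⟩
    · fin_cases i
      · exact sub_nonneg.2 p.1.2.2
      · exact mul_nonneg p.1.2.1 (sub_nonneg.2 p.2.2.2)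
      · exact mul_nonneg p.1.2.1 p.2.2.1
    · simp [Fin.sum_univ_three]
      ring⟩

/-- Coordinates of the square parametrisation. [folklore] -/
lemma squareToTwo_apply_zero (p : unitInterval × unitInterval) : (squareToTwo p : Fin 3 → ℝ) 0 = 1 - p.1 := rfl
/-- Coordinates of the square parametrisation. [folklore] -/
lemma squareToTwo_apply_one (p : unitInterval × unitInterval) : (squareToTwo p : Fin 3 → ℝ) 1 = p.1 * (1 - p.2) := rfl
/-- Coordinates of the square parametrisation. [folklore] -/
lemma squareToTwo_apply_two (p : unitInterval × unitInterval) : (squareToTwo p : Fin 3 → ℝ) 2 = p.1 * p.2 := rfl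

/-- The square parametrisation is continuous. [folklore] -/
lemma continuous_squareToTwo : Continuous squareToTwo := by
  refine Continuous.subtype_mk (continuous_pi fun i => ?_) _
  fin_cases i
  · change Continuous fun p : unitInterval × unitInterval => (1 : ℝ) - p.1
    fun_prop
  · change Continuous fun p : unitInterval × unitInterval => (p.1 : ℝ) * (1 - p.2)
    fun_prop
  · change Continuous fun p : unitInterval × unitInterval => (p.1 : ℝ) * p.2
    fun_prop

/-- Bottom edge of the square: `(t, 0) ↦ δ₂ (1 - t, t) = (1 - t, t, 0)`. [folklore] -/
lemma squareToTwo_bottom (t : unitInterval) :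
    squareToTwo (t, 0) = stdSimplex.map (Fin.succAbove (2 : Fin 3)) (ofUnitInterval t) := by
  apply stdSimplex.ext
  funext i
  fin_cases i
  · show (squareToTwo (t, 0) : Fin 3 → ℝ) 0 = (stdSimplex.map (Fin.succAbove (2 : Fin 3))
      (ofUnitInterval t) : Fin 3 → ℝ) 0
    rw [map_succAbove_two_apply_zero, squareToTwo_apply_zero, ofUnitInterval_apply_zero]
  · show (squareToTwo (t, 0) : Fin 3 → ℝ) 1 = (stdSimplex.map (Fin.succAbove (2 : Fin 3))
      (ofUnitInterval t) : Fin 3 → ℝ) 1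
    rw [map_succAbove_two_apply_one, squareToTwo_apply_one, ofUnitInterval_apply_one]
    simp
  · show (squareToTwo (t, 0) : Fin 3 → ℝ) 2 = (stdSimplex.map (Fin.succAbove (2 : Fin 3))
      (ofUnitInterval t) : Fin 3 → ℝ) 2
    rw [map_succAbove_two_apply_two, squareToTwo_apply_two]
    simp

/-- Right edge of the square: `(1, t) ↦ δ₀ (1 - t, t) = (0, 1 - t, t)`. [folklore] -/
lemma squareToTwo_right (t : unitInterval) :
    squareToTwo (1, t) = stdSimplex.map (Fin.succAbove (0 : Fin 3)) (ofUnitInterval t) := by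
  apply stdSimplex.ext
  funext i
  fin_cases i
  · show (squareToTwo (1, t) : Fin 3 → ℝ) 0 = (stdSimplex.map (Fin.succAbove (0 : Fin 3))
      (ofUnitInterval t) : Fin 3 → ℝ) 0
    rw [map_succAbove_zero_apply_zero, squareToTwo_apply_zero]
    simp
  · show (squareToTwo (1, t) : Fin 3 → ℝ) 1 = (stdSimplex.map (Fin.succAbove (0 : Fin 3))
      (ofUnitInterval t) : Fin 3 → ℝ) 1
    rw [map_succAbove_zero_apply_one, squareToTwo_apply_one, ofUnitInterval_apply_zero]
    simp
  · show (squareToTwo (1, t) : Fin 3 → ℝ) 2 = (stdSimplex.map (Fin.succAbove (0 : Fin 3))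
      (ofUnitInterval t) : Fin 3 → ℝ) 2
    rw [map_succAbove_zero_apply_two, squareToTwo_apply_two, ofUnitInterval_apply_one]
    simp

/-- Top edge of the square: `(t, 1) ↦ δ₁ (1 - t, t) = (1 - t, 0, t)`. [folklore] -/
lemma squareToTwo_top (t : unitInterval) :
    squareToTwo (t, 1) = stdSimplex.map (Fin.succAbove (1 : Fin 3)) (ofUnitInterval t) := by
  apply stdSimplex.ext
  funext i
  fin_cases i
  · show (squareToTwo (t, 1) : Fin 3 → ℝ) 0 = (stdSimplex.map (Fin.succAbove (1 : Fin 3))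
      (ofUnitInterval t) : Fin 3 → ℝ) 0
    rw [map_succAbove_one_apply_zero, squareToTwo_apply_zero, ofUnitInterval_apply_zero]
  · show (squareToTwo (t, 1) : Fin 3 → ℝ) 1 = (stdSimplex.map (Fin.succAbove (1 : Fin 3))
      (ofUnitInterval t) : Fin 3 → ℝ) 1
    rw [map_succAbove_one_apply_one, squareToTwo_apply_one]
    simp
  · show (squareToTwo (t, 1) : Fin 3 → ℝ) 2 = (stdSimplex.map (Fin.succAbove (1 : Fin 3))
      (ofUnitInterval t) : Fin 3 → ℝ) 2
    rw [map_succAbove_one_apply_two, squareToTwo_apply_two, ofUnitInterval_apply_one]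
    simp

/-- The left edge of the square is collapsed: `(0, t) ↦ e₀`. [folklore] -/
lemma squareToTwo_left (t : unitInterval) : squareToTwo (0, t) = squareToTwo (0, 0) := by
  apply stdSimplex.ext
  funext i
  fin_cases i
  · show (squareToTwo (0, t) : Fin 3 → ℝ) 0 = (squareToTwo (0, 0) : Fin 3 → ℝ) 0
    rw [squareToTwo_apply_zero, squareToTwo_apply_zero]
  · show (squareToTwo (0, t) : Fin 3 → ℝ) 1 = (squareToTwo (0, 0) : Fin 3 → ℝ) 1
    rw [squareToTwo_apply_one, squareToTwo_apply_one]
    simp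
  · show (squareToTwo (0, t) : Fin 3 → ℝ) 2 = (squareToTwo (0, 0) : Fin 3 → ℝ) 2
    rw [squareToTwo_apply_two, squareToTwo_apply_two]
    simp

end StdSimplex

/-! ### Logarithms along singular simplices of the punctured plane -/

section EdgeLog

/-- The **edge function** of a singular `1`-simplex `σ` of `ℂ ∖ 0`: `t ↦ σ(1 - t, t)` read on
`[0, 1]` (extended constantly outside), a continuous nowhere-vanishing map `ℝ → ℂ`. [folklore] -/
def edgeFun (σ : SingularSimplex CStar 1) (t : ℝ) : ℂ :=
  (toContinuousMap σ (ofUnitInterval (projIcc 0 1 zero_le_one t)) : ℂ)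

/-- The edge function is continuous. [folklore] -/
lemma continuous_edgeFun (σ : SingularSimplex CStar 1) : Continuous (edgeFun σ) :=
  continuous_subtype_val.comp ((toContinuousMap σ).continuous.comp
    (continuous_ofUnitInterval.comp continuous_projIcc))

/-- The edge function does not vanish. [folklore] -/
lemma edgeFun_ne_zero (σ : SingularSimplex CStar 1) (t : ℝ) : edgeFun σ t ≠ 0 :=
  (toContinuousMap σ _).2

/-- The edge function on `[0, 1]`. [folklore] -/
lemma edgeFun_apply_of_mem (σ : SingularSimplex CStar 1) {t : ℝ} (ht : t ∈ Icc (0 : ℝ) 1) :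
    edgeFun σ t = toContinuousMap σ (ofUnitInterval ⟨t, ht⟩) := by
  rw [edgeFun, projIcc_of_mem _ ht]

/-- The edge function has a continuous logarithm on `ℝ`. [folklore] -/
lemma hasLogOn_edgeFun (σ : SingularSimplex CStar 1) : Literature.Topology.PlaneTopology.HasLogOn (edgeFun σ) univ :=
  Literature.Topology.PlaneTopology.hasLogOn_univ Literature.Topology.PlaneTopology.isSimplyConnected_univ_real (continuous_edgeFun σ) (edgeFun_ne_zero σ)

/-- The **logarithmic increment** `∫_σ dz/z = l(1) - l(0)` along a singular `1`-simplex `σ` of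
`ℂ ∖ 0`, for any continuous logarithm `l` of its edge function on `[0, 1]` (`edgeLog_eq`).
[folklore] -/
def edgeLog (σ : SingularSimplex CStar 1) : ℂ :=
  (hasLogOn_edgeFun σ).choose 1 - (hasLogOn_edgeFun σ).choose 0

/-- Any continuous logarithm of the edge function on `[0, 1]` computes `edgeLog`. [folklore] -/
lemma edgeLog_eq {σ : SingularSimplex CStar 1} {l : ℝ → ℂ} (hl : ContinuousOn l (Icc 0 1))
    (hle : ∀ t ∈ Icc (0 : ℝ) 1, exp (l t) = edgeFun σ t) : edgeLog σ = l 1 - l 0 := by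
  obtain ⟨hc, he⟩ := (hasLogOn_edgeFun σ).choose_spec
  obtain ⟨n, hn⟩ := Literature.Topology.PlaneTopology.exists_int_eq_add_of_exp_eq isPreconnected_Icc (hc.mono (subset_univ _)) hl
    fun t ht => by rw [he t trivial, hle t ht]
  rw [edgeLog, hn 1 ⟨zero_le_one, le_rfl⟩, hn 0 ⟨le_rfl, zero_le_one⟩]
  ring

/-- The **square function** of a singular `2`-simplex `τ` of `ℂ ∖ 0`: `τ` composed with the
square parametrisation of `Δ²`, read on `[0, 1]² ⊆ ℂ` (extended constantly outside): a continuous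
nowhere-vanishing map `ℂ → ℂ`. [folklore] -/
def squareFun (τ : SingularSimplex CStar 2) (w : ℂ) : ℂ :=
  (toContinuousMap τ (squareToTwo (projIcc 0 1 zero_le_one w.re, projIcc 0 1 zero_le_one w.im)) : ℂ)

/-- The square function is continuous. [folklore] -/
lemma continuous_squareFun (τ : SingularSimplex CStar 2) : Continuous (squareFun τ) :=
  continuous_subtype_val.comp ((toContinuousMap τ).continuous.comp
    (continuous_squareToTwo.comp ((continuous_projIcc.comp continuous_re).prodMk
      (continuous_projIcc.comp continuous_im))))

/-- The square function does not vanish. [folklore] -/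
lemma squareFun_ne_zero (τ : SingularSimplex CStar 2) (w : ℂ) : squareFun τ w ≠ 0 :=
  (toContinuousMap τ _).2

/-- The square function has a continuous logarithm on `ℂ`. [folklore] -/
lemma hasLogOn_squareFun (τ : SingularSimplex CStar 2) : Literature.Topology.PlaneTopology.HasLogOn (squareFun τ) univ :=
  Literature.Topology.PlaneTopology.hasLogOn_univ Literature.Topology.PlaneTopology.isSimplyConnected_univ_complex (continuous_squareFun τ) (squareFun_ne_zero τ)

/-- The square function at `s + ti` for `s, t ∈ [0, 1]`. [folklore] -/
lemma squareFun_apply (τ : SingularSimplex CStar 2) (s t : unitInterval) :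
    squareFun τ ((s : ℝ) + (t : ℝ) * Complex.I) = toContinuousMap τ (squareToTwo (s, t)) := by
  have hre : ((s : ℝ) + (t : ℝ) * Complex.I : ℂ).re = s := by simp
  have him : ((s : ℝ) + (t : ℝ) * Complex.I : ℂ).im = t := by simp
  rw [squareFun, hre, him, projIcc_of_mem _ s.2, projIcc_of_mem _ t.2]

variable (τ : SingularSimplex CStar 2) {L : ℂ → ℂ} (hL : Continuous L)
  (hLe : ∀ w, exp (L w) = squareFun τ w)
include hL hLe

/-- Bottom edge: `edgeLog (τ ∘ δ₂) = L(1) - L(0)`. [folklore] -/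
lemma edgeLog_face_two : edgeLog (τ.face 2) = L 1 - L 0 := by
  have h := edgeLog_eq (σ := τ.face 2) (l := fun t => L t) (by fun_prop) fun t ht => by
    rw [show ((t : ℝ) : ℂ) = ((⟨t, ht⟩ : unitInterval) : ℝ) + ((0 : unitInterval) : ℝ) * Complex.I by
        simp, hLe, squareFun_apply, edgeFun_apply_of_mem _ ht, toContinuousMap_face,
      ContinuousMap.comp_apply, squareToTwo_bottom]
    rfl
  simpa using h

/-- Right edge: `edgeLog (τ ∘ δ₀) = L(1 + i) - L(1)`. [folklore] -/
lemma edgeLog_face_zero : edgeLog (τ.face 0) = L (1 + Complex.I) - L 1 := by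
  have h := edgeLog_eq (σ := τ.face 0) (l := fun t => L (1 + t * Complex.I)) (by fun_prop)
    fun t ht => by
    rw [show (1 : ℂ) + t * Complex.I = ((1 : unitInterval) : ℝ) + ((⟨t, ht⟩ : unitInterval) : ℝ) *
        Complex.I by simp, hLe, squareFun_apply, edgeFun_apply_of_mem _ ht, toContinuousMap_face,
      ContinuousMap.comp_apply, squareToTwo_right]
    rfl
  simpa using h

/-- Top edge: `edgeLog (τ ∘ δ₁) = L(1 + i) - L(i)`. [folklore] -/
lemma edgeLog_face_one : edgeLog (τ.face 1) = L (1 + Complex.I) - L Complex.I := by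
  have h := edgeLog_eq (σ := τ.face 1) (l := fun t => L (t + Complex.I)) (by fun_prop)
    fun t ht => by
    rw [show (t : ℂ) + Complex.I = ((⟨t, ht⟩ : unitInterval) : ℝ) + ((1 : unitInterval) : ℝ) *
        Complex.I by simp, hLe, squareFun_apply, edgeFun_apply_of_mem _ ht, toContinuousMap_face,
      ContinuousMap.comp_apply, squareToTwo_top]
    rfl
  simpa using h

/-- Left (collapsed) edge: `L(i) = L(0)`, the logarithm of a constant being constant on `[0, 1]`.
[folklore] -/
lemma log_I_eq_log_zero : L Complex.I = L 0 := by
  have hconst : ∀ t ∈ Icc (0 : ℝ) 1, exp (L (t * Complex.I)) = exp (L 0) := fun t ht => by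
    rw [show (t : ℂ) * Complex.I = ((0 : unitInterval) : ℝ) + ((⟨t, ht⟩ : unitInterval) : ℝ) *
        Complex.I by simp, show (0 : ℂ) = ((0 : unitInterval) : ℝ) + ((0 : unitInterval) : ℝ) *
        Complex.I by simp, hLe, hLe, squareFun_apply, squareFun_apply, squareToTwo_left]
  obtain ⟨n, hn⟩ := Literature.Topology.PlaneTopology.exists_int_eq_add_of_exp_eq (l := fun t : ℝ => L (t * Complex.I))
    (m := fun _ => L 0) isPreconnected_Icc (by fun_prop) continuousOn_const hconst
  have h0 := hn 0 ⟨le_rfl, zero_le_one⟩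
  have h1 := hn 1 ⟨zero_le_one, le_rfl⟩
  simp only [ofReal_zero, zero_mul, ofReal_one, one_mul] at h0 h1
  have hn0 : (n : ℂ) * (2 * Real.pi * Complex.I) = 0 := by linear_combination -h0
  rw [h1, hn0, add_zero]

/-- **The logarithmic increments around the boundary of a singular `2`-simplex of `ℂ ∖ 0` cancel**:
`edgeLog (τ∘δ₀) - edgeLog (τ∘δ₁) + edgeLog (τ∘δ₂) = 0` (the three edges lift along one global
logarithm of `τ` on the square). [folklore] -/
lemma edgeLog_boundary : edgeLog (τ.face 0) - edgeLog (τ.face 1) + edgeLog (τ.face 2) = 0 := by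
  rw [edgeLog_face_zero τ hL hLe, edgeLog_face_one τ hL hLe, edgeLog_face_two τ hL hLe,
    log_I_eq_log_zero τ hL hLe]
  ring

omit hL hLe in
/-- The cocycle identity for every singular `2`-simplex of `ℂ ∖ 0`. [folklore] -/
lemma edgeLog_boundary' : edgeLog (τ.face 0) - edgeLog (τ.face 1) + edgeLog (τ.face 2) = 0 := by
  obtain ⟨L, hL, hLe⟩ := hasLogOn_squareFun τ
  exact edgeLog_boundary τ (continuousOn_univ.1 hL) fun w => hLe w trivial

end EdgeLog

/-! ### The winding functional on `H₁(ℂ ∖ 0; ℤ)` -/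

section Functional

/-- The winding functional on **concrete** singular `1`-chains of `ℂ ∖ 0`:
`∑ kᵢ σᵢ ↦ ∑ kᵢ edgeLog σᵢ`. [folklore] -/
def windFunConcrete : CChain ℤ CStar 1 →ₗ[ℤ] ℂ :=
  Finsupp.lsum ℤ fun σ => LinearMap.toSpanSingleton ℤ ℂ (edgeLog σ)

/-- The concrete winding functional on an elementary chain. [folklore] -/
@[simp] lemma windFunConcrete_single (σ : SingularSimplex CStar 1) (k : ℤ) :
    windFunConcrete (Finsupp.single σ k) = k • edgeLog σ := by
  simp [windFunConcrete]

/-- The **winding functional on singular `1`-chains** of `ℂ ∖ 0` (Mathlib's model), through the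
comparison isomorphism with concrete chains. [folklore] -/
def windFun : ((singularChainComplex ℤ ℤ CStar).X 1) →ₗ[ℤ] ℂ :=
  windFunConcrete ∘ₗ ((csingularChainComplex.compIso ℤ ℤ CStar).inv.f 1).hom

/-- The inverse comparison isomorphism on an elementary chain (`ℤ` coefficients; the general
statement is `csingularChainComplex.compIso_inv_f_single` in `…RelativeCapProduct`, not imported
here). [folklore] -/
private lemma compIso_inv_f_single' {X : Type} [TopologicalSpace X] {n : ℕ} (σ : SingularSimplex X n)
    (k : ℤ) : (csingularChainComplex.compIso ℤ ℤ X).inv.f n (single (R := ℤ) σ k) =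
      (Finsupp.single σ k : CChain ℤ X n) := by
  have h := congrArg (fun φ => φ.f n (Finsupp.single σ k : CChain ℤ X n))
    (csingularChainComplex.compIso ℤ ℤ X).hom_inv_id
  simp only [HomologicalComplex.comp_f, ModuleCat.comp_apply, HomologicalComplex.id_f,
    ModuleCat.id_apply, csingularChainComplex.compIso_hom_f_single] at h
  exact h

/-- The winding functional on an elementary chain: `windFun (k σ) = k · edgeLog σ`. [folklore] -/
@[simp] lemma windFun_single (σ : SingularSimplex CStar 1) (k : ℤ) :
    windFun (single (R := ℤ) σ k) = k • edgeLog σ := by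
  rw [windFun, LinearMap.comp_apply]
  change windFunConcrete ((csingularChainComplex.compIso ℤ ℤ CStar).inv.f 1 (single (R := ℤ) σ k)) = _
  rw [compIso_inv_f_single', windFunConcrete_single]

/-- **The winding functional vanishes on boundaries** (the cocycle identity `edgeLog_boundary'`).
[folklore] -/
lemma windFun_comp_d :
    windFun ∘ₗ ((singularChainComplex ℤ ℤ CStar).d 2 1).hom = 0 := by
  have h : ModuleCat.ofHom (windFun ∘ₗ ((singularChainComplex ℤ ℤ CStar).d 2 1).hom) =
      (ModuleCat.ofHom (0 : (singularChainComplex ℤ ℤ CStar).X 2 →ₗ[ℤ] ℂ) :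
        (singularChainComplex ℤ ℤ CStar).X 2 ⟶ ModuleCat.of ℤ ℂ) := by
    refine singularChainComplex.hom_ext fun τ k => ?_
    change windFun ((singularChainComplex ℤ ℤ CStar).d 2 1 (single (R := ℤ) τ k)) = 0
    rw [d_single_two, map_add, map_sub, windFun_single, windFun_single, windFun_single, ← smul_sub,
      ← smul_add, edgeLog_boundary', smul_zero]
  exact congrArg ModuleCat.Hom.hom h

/-- The **winding functional on `H₁(ℂ ∖ 0; ℤ)`**, `[∑ kᵢ σᵢ] ↦ ∑ kᵢ ∫_{σᵢ} dz/z` (the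
de Rham pairing with `dz/z`, realised through continuous logarithms). [folklore] -/
def windH : singularHomology ℤ ℤ CStar 1 →ₗ[ℤ] ℂ :=
  homologyDesc' 2 (ChainComplex.prev ℕ 1) windFun windFun_comp_d

/-- The winding functional on the Hurewicz class of a loop is the logarithmic increment along it.
[folklore] -/
lemma windH_loopClass {b : CStar} (γ : Path b b) :
    windH (loopClass ℤ ℤ (1 : ℤ) γ) = edgeLog (ofPath γ) := by
  rw [windH, loopClass, homologyDesc'_cls, windFun_single, one_smul]

/-- The edge function of the `1`-simplex of a path is the path (on `[0, 1]`). [folklore] -/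
lemma edgeFun_ofPath {b c : CStar} (γ : Path b c) {t : ℝ} (ht : t ∈ Icc (0 : ℝ) 1) :
    edgeFun (ofPath γ) t = γ ⟨t, ht⟩ := by
  rw [edgeFun_apply_of_mem _ ht, ofPath_apply, toUnitInterval_ofUnitInterval]

/-- **The logarithmic increment along the winding loop `t ↦ r e^{2πit}` is `2πi`.** [folklore] -/
lemma edgeLog_ofPath_windingLoop (r : ℝ) (hr : 0 < r) :
    edgeLog (ofPath (windingLoop r hr 1)) = 2 * Real.pi * Complex.I := by
  rw [edgeLog_eq (l := fun t : ℝ => (Real.log r : ℂ) + 2 * Real.pi * t * Complex.I) (by fun_prop)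
    fun t ht => ?_]
  · simp only [ofReal_one, mul_one, ofReal_zero, mul_zero, zero_mul, add_zero]
    ring
  · rw [edgeFun_ofPath _ ht, windingLoop_apply_coe, Complex.exp_add, ← Complex.ofReal_exp,
      Real.exp_log hr]
    congr 1
    push_cast
    ring_nf

/-- The winding functional on the Hurewicz class of the winding loop is `2πi`. [folklore] -/
lemma windH_loopClass_windingLoop (r : ℝ) (hr : 0 < r) :
    windH (loopClass ℤ ℤ (1 : ℤ) (windingLoop r hr 1)) = 2 * Real.pi * Complex.I := by
  rw [windH_loopClass, edgeLog_ofPath_windingLoop]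

/-- **The Hurewicz class of the winding loop has infinite order in `H₁(ℂ ∖ 0; ℤ)`**:
`k ↦ k • h(winding loop)` is injective. [folklore] -/
theorem loopClass_windingLoop_smul_injective (r : ℝ) (hr : 0 < r) :
    Function.Injective fun k : ℤ => k • loopClass ℤ ℤ (1 : ℤ) (windingLoop r hr 1) := by
  intro k l hkl
  have h := congrArg windH hkl
  simp only [map_zsmul, windH_loopClass_windingLoop] at h
  have h2 : (2 * Real.pi * Complex.I : ℂ) ≠ 0 := by simp [Real.pi_ne_zero, Complex.I_ne_zero]
  have h3 : ((k : ℂ) - l) * (2 * Real.pi * Complex.I) = 0 := by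
    rw [sub_mul]
    simpa [zsmul_eq_mul, sub_eq_zero] using h
  rcases mul_eq_zero.1 h3 with h4 | h4
  · exact_mod_cast sub_eq_zero.1 h4
  · exact absurd h4 h2

/-- **The winding loop has infinite order in `π₁(ℂ ∖ 0)ᵃᵇ`** (in fact in `π₁`; Hatcher 2002,
Thm. 1.7): `k ↦ [winding loop]ᵃᵇ ^ k` is injective. [cite: HatcherAT2002, Thm. 1.7] -/
theorem zpow_abelianization_windingLoop_injective (r : ℝ) (hr : 0 < r) :
    Function.Injective fun k : ℤ => (Abelianization.of (FundamentalGroup.fromPath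
      (Path.Homotopic.Quotient.mk (windingLoop r hr 1)))) ^ k :=
  zpow_abelianization_injective_of_loopClass ℤ ℤ 1 _ (loopClass_windingLoop_smul_injective r hr)

end Functional

end WindingPart

end Literature.AlgebraicTopology.SingularHomology
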